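import Summits.MatrixMultiplication.OmegaCensus.STPP211Z2pow6NFCertsData2

/-!
# (2,1,1)¹⁰ ⊄ (ℤ/2)⁶ — part H3b: the 456 orbit certificates are correct (kernel)

Cell `pub-omega` (unit `pub-omega-stpp-1-g36`), topic `Summits/MatrixMultiplication/OmegaCensus`.
HONEST FRAMING (verbatim): lottery ticket; floor = certified bounds/negative ranges. Census STRUCTURE bookkeeping (B5, `T1((ℤ/2)⁶)`, Pb237);
nothing here is a bound on `ω`.

For every row `(d, C, t, h, r)` of `certs` (`STPP211Z2pow6NFCertsData1/2`): the column list `h` passes `linOK` (six codes `< 64`, trivial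
kernel — with the generic additivity `linC_xor` this makes `lin h` an injective homomorphism of `G6`, `STPP211Z2pow6NFMapsD`), and the map
`x ↦ lin h (x + dec t)` carries the code set `C` onto the representative `reps29[r−1]` (as finsets of `G6`). Kernel decisions `certsA_ok`,
`certsB_ok`; read back as `certs_spec`. Also `reps29_ok`: the 29 representative lists are ten distinct codes `< 64` starting with `0`.
What remains for `exists_repNF` (successor, HOME `pub-omega-stpp-1-g36/S3-RECIPE.md`): the COVER step «every frame normal form is carried by
a coordinate permutation onto one of the 456 listed canonical sets `C`» and the assembly with `STPP211Z2pow6FrameNF.exists_frameNF`.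

References: H. Cohn, R. Kleinberg, B. Szegedy, C. Umans, FOCS 2005 (arXiv:math/0511460), Def. 5.1.
-/

namespace Summit.MatrixMultiplication.OmegaCensus

namespace T1Z2p6

open Finset

/-- A code list as a set of elements of `G6`. -/
def setOf (l : List ℕ) : Finset G6 := (l.map dec).toFinset

/-- The check of one certificate row `(d, C, t, h, r)`: `linOK h` and `(C + dec t).image (lin h) = reps29[r−1]` as finsets. -/
def certOK (row : ℕ × List ℕ × ℕ × List ℕ × ℕ) : Bool :=
  linOK row.2.2.2.1 &&
    decide (((setOf row.2.1).image (· + dec row.2.2.1)).image (linFun row.2.2.2.1) = setOf (reps29.getD (row.2.2.2.2 - 1) []))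

/-- KERNEL: rows 1–228 pass. -/
theorem certsA_ok : certsA.all certOK = true := by decide +kernel

/-- KERNEL: rows 229–456 pass. -/
theorem certsB_ok : certsB.all certOK = true := by decide +kernel

/-- All rows pass. -/
theorem certs_ok : certs.all certOK = true := by
  rw [certs, List.all_append, certsA_ok, certsB_ok]; rfl

/-- **Reading the certificates:** for every row, `lin h` (an injective homomorphism) carries `C + dec t` onto the representative set. -/
theorem certs_spec (row : ℕ × List ℕ × ℕ × List ℕ × ℕ) (hr : row ∈ certs) :
    ∃ hc : linOK row.2.2.2.1 = true,
      ((setOf row.2.1).image (· + dec row.2.2.1)).image (lin row.2.2.2.1 hc) = setOf (reps29.getD (row.2.2.2.2 - 1) []) := by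
  have h := List.all_eq_true.1 certs_ok row hr
  unfold certOK at h
  rw [Bool.and_eq_true, decide_eq_true_eq] at h
  exact ⟨h.1, h.2⟩

/-- KERNEL: the 29 representative lists are ten pairwise distinct codes `< 64`, the first being `0`, and every row of `certs` points at one
of them (`1 ≤ r ≤ 29`) with a ten-code canonical set. -/
theorem reps29_ok : (reps29.length = 29 ∧ reps29.all (fun r => r.length == 10 && r.Nodup && r.all (· < 64) && (r.getD 0 1 == 0)) = true) ∧
    certs.all (fun row => Nat.ble 1 row.2.2.2.2 && Nat.ble row.2.2.2.2 29 && (row.2.1.length == 10)) = true := by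
  exact ⟨⟨rfl, by decide +kernel⟩, by decide +kernel⟩

end T1Z2p6

end Summit.MatrixMultiplication.OmegaCensus
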